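import Summits.Ventures.Crystal3D.Bulk.L2bFrames
import Summits.Ventures.Crystal3D.Bulk.L2bTables
import HarnessLib

/-!
# L2B, file 3: hexagon transfer from an HCP-type neighbour, and no tilted HCP neighbours of an FCC centre

HONEST FRAMING. Part of the venture `Summits/Ventures/Crystal3D` (cell `pub-crystal3d`, phase 2), a brick
of the radius-2 lemma `RadiusTwoBarlow` (`Bulk/PositionalOrder.lean`; design `HOME/lean/l2b/DESIGN.md`).
Elementary geometry of close-packed tangent arrangements in Hales's normalisation (`kissingShell`,
contact distance `2`); no definition, no notation.

## Contents (namespace `Summit.Ventures.Crystal3D.L2B`)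

* `ncard_hexagonSet` — the standard hexagon has six points.
* **`hexagon_transfer`** — if `p` is a neighbour of `x` with an HCP tangent arrangement whose mirror
  plane misses `x` (`p − x ∉ kissingShell V p`), and the common neighbours of `x` and `p` have FCC/HCP
  tangent arrangements, then every mirror direction of `p` (every `y` with `y, −y ∈ kissingShell V p`)
  is a shell vector of `x`: the shell of `x` contains the hexagon parallel to the mirror plane of `p`.
* `mirror_eq_image` — the mirror directions of an HCP-type ball form an isometric image of the
  standard hexagon.
* **`ring_not_hcp`** — «STEP B»: in a frame where the shell of the FCC-type centre `0` is the
  cuboctahedron `layerShell σ (−σ)` and some polar neighbour `d` has the HORIZONTAL HCP shell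
  `layerShell s s`, no hexagon (same-layer) neighbour `η` has an HCP tangent arrangement — provided the
  balls within contact distance `2` of the centre have FCC/HCP arrangements. (A tilted mirror hexagon
  `H′` of `η` would give, by the witness lemma `cubo_witness`, a second-shell ball `p + q` whose shell
  equals both the shell of the horizontal face and the shell of the tilted face — two mirror planes.)
-/

noncomputable section

namespace Summit.Ventures.Crystal3D.L2B

open Literature.Geometry.DiscreteGeometry Literature.MathematicalPhysics.StatisticalMechanics
open RealInnerProductSpace

variable {V : Set (EuclideanSpace ℝ (Fin 3))}

/-- The standard hexagon has six points. -/
theorem ncard_hexagonSet : (hexagonSet : Set (EuclideanSpace ℝ (Fin 3))).ncard = 6 := by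
  have heq : (hexagonSet : Set (EuclideanSpace ℝ (Fin 3))) =
      (fun t : ℤ × ℤ × ℤ => uveCombo ((t.1 : ℝ) / 3) ((t.2.1 : ℝ) / 3) ((t.2.2 : ℝ) / 2)) ''
        (({((3 : ℤ), (0 : ℤ), (0 : ℤ)), (-3, 0, 0), (0, 3, 0), (0, -3, 0), (3, -3, 0), (-3, 3, 0)} :
          Finset (ℤ × ℤ × ℤ)) : Set (ℤ × ℤ × ℤ)) := by
    ext x
    simp only [mem_hexagonSet_iff_table, Set.mem_image, Finset.mem_coe, eq_comm]
  rw [heq, Set.ncard_image_of_injective _ (fun t t' h => uveCombo_table_inj h), Set.ncard_coe_finset]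
  decide

/-! ## Hexagon transfer -/

/-- **Hexagon transfer from an HCP-type neighbour.** Let `x ∈ V` and let `p` be a neighbour of `x`
(`p − x ∈ kissingShell V x`) whose tangent arrangement is an HCP pattern and whose mirror plane does
not pass through `x` (`p − x ∉ kissingShell V p`: the antipode of `x − p` is not a shell vector of
`p`). If the common neighbours `p + z` of `p` and `x` have FCC/HCP tangent arrangements, then every
mirror direction `y` of `p` (`y` and `−y` in the shell of `p`) is a shell vector of `x`. -/
theorem hexagon_transfer (hV : IsUnitBallPacking V) {x p : EuclideanSpace ℝ (Fin 3)} (hxV : x ∈ V)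
    (hp : p - x ∈ kissingShell V x) (hhcp : IsArrangedIn (kissingShell V p) hcpKissingPattern)
    (hpol : p - x ∉ kissingShell V p)
    (hcp : ∀ z ∈ kissingShell V p, ⟪z - (x - p), z - (x - p)⟫ = 4 →
      IsArrangedIn (kissingShell V (p + z)) fccKissingPattern ∨
        IsArrangedIn (kissingShell V (p + z)) hcpKissingPattern)
    {y : EuclideanSpace ℝ (Fin 3)} (hy : y ∈ kissingShell V p) (hy' : -y ∈ kissingShell V p) :
    y ∈ kissingShell V x := by
  obtain ⟨L, s, hs, hS0⟩ := exists_hcp_frame hV hhcp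
  have hW : IsUnitBallPacking {z | p + L z ∈ V} := hV.preimage p L
  have hpV : p ∈ V := by
    have h3 := hp.1; rwa [add_sub_cancel] at h3
  have h0 : (0 : EuclideanSpace ℝ (Fin 3)) ∈ {z | p + L z ∈ V} := by simpa using hpV
  have hS0' : kissingShell {z | p + L z ∈ V} 0 = L ⁻¹' kissingShell V p := by
    rw [kissingShell_moved]; simp
  -- the position of `x` in the frame is polar
  have hnorm : ‖x - p‖ = 2 := by rw [norm_sub_rev]; exact hp.2
  have hx' : L.symm (x - p) ∈ layerShell s s := by
    rw [← hS0, hS0']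
    refine ⟨?_, by simpa using hnorm⟩
    simpa using hxV
  have hx'neg : -L.symm (x - p) ∉ layerShell s s := by
    intro h
    rw [← hS0, hS0'] at h
    apply hpol
    have h' : L (-L.symm (x - p)) ∈ kissingShell V p := h
    simpa [neg_sub] using h'
  have hx'H : L.symm (x - p) ∉ hexagonSet := fun h =>
    hx'neg (hexagonSet_subset_layerShell s s (neg_mem_hexagonSet h))
  -- the direction `y` in the frame is a hexagon vector
  have hy1 : L.symm y ∈ layerShell s s := by rw [← hS0, hS0']; simpa using hy
  have hy2 : -L.symm y ∈ layerShell s s := by rw [← hS0, hS0']; simpa using hy'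
  have hyH : L.symm y ∈ hexagonSet := mem_hexagonSet_of_neg_mem hs hy1 hy2
  -- membership of `x + y` from membership of `x' + y'` in the moved packing
  have key : L.symm (x - p) + L.symm y ∈ {z | p + L z ∈ V} → y ∈ kissingShell V x := by
    intro h
    refine ⟨?_, hy.2⟩
    have : p + L (L.symm (x - p) + L.symm y) = x + y := by
      rw [map_add, LinearIsometryEquiv.apply_symm_apply, LinearIsometryEquiv.apply_symm_apply]; abel
    rw [← this]; exact h
  rcases polar_add_hexagon_mem hs hx' hx'H hyH with h | ⟨ζ, hζH, hζd, hmem⟩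
  · apply key
    rw [← hS0] at h
    simpa using h.1
  · -- the hexagon point `ζ` is a common neighbour of `p` and `x`, hence has an FCC/HCP shell
    have hζS : ζ ∈ kissingShell {z | p + L z ∈ V} 0 := hS0 ▸ hexagonSet_subset_layerShell s s hζH
    have hzp : L ζ ∈ kissingShell V p := by rw [hS0'] at hζS; exact hζS
    have hdist : ⟪L ζ - (x - p), L ζ - (x - p)⟫ = 4 := by
      have : L ζ - (x - p) = L (ζ - L.symm (x - p)) := by
        rw [map_sub, LinearIsometryEquiv.apply_symm_apply]
      rw [this, LinearIsometryEquiv.inner_map_map, hζd]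
    have hcpζ : IsArrangedIn (kissingShell {z | p + L z ∈ V} (0 + ζ)) fccKissingPattern ∨
        IsArrangedIn (kissingShell {z | p + L z ∈ V} (0 + ζ)) hcpKissingPattern := by
      rw [zero_add, kissingShell_moved]
      exact (hcp _ hzp hdist).imp (fun h => h.preimage L) (fun h => h.preimage L)
    obtain ⟨-, hSζ⟩ := kissingShell_add_eq_layerShell_of_hcp_hexagon hW hs h0 hS0 hζH hcpζ
    apply key
    have hm : L.symm (x - p) + L.symm y - ζ ∈ kissingShell {z | p + L z ∈ V} (0 + ζ) := hSζ ▸ hmem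
    have := hm.1
    rw [zero_add, add_sub_cancel] at this
    exact this

/-! ## No tilted HCP-type neighbours in the hexagon of an FCC-type centre -/

/-- Mirror directions of a ball with shell `layerShell s s` are hexagon vectors, and conversely. -/
theorem mirror_iff_hexagon {s : ℝ} (hs : s = 1 ∨ s = -1) {c y : EuclideanSpace ℝ (Fin 3)}
    (hSc : kissingShell V c = layerShell s s) :
    (y ∈ kissingShell V c ∧ -y ∈ kissingShell V c) ↔ y ∈ hexagonSet := by
  rw [hSc]
  exact ⟨fun h => mem_hexagonSet_of_neg_mem hs h.1 h.2,
    fun h => ⟨hexagonSet_subset_layerShell s s h, neg_mem_layerShell_of_mem_hexagonSet s s h⟩⟩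

/-- A ball with shell `layerShell s s` keeps its shell along every hexagon direction whose endpoint has
an FCC/HCP shell (frame-free HCP step specialised). -/
theorem shell_eq_of_layerShell (hV : IsUnitBallPacking V) {s : ℝ} (hs : s = 1 ∨ s = -1)
    {c ζ : EuclideanSpace ℝ (Fin 3)} (hc : c ∈ V) (hSc : kissingShell V c = layerShell s s)
    (hζ : ζ ∈ hexagonSet)
    (hcp : IsArrangedIn (kissingShell V (c + ζ)) fccKissingPattern ∨
      IsArrangedIn (kissingShell V (c + ζ)) hcpKissingPattern) :
    kissingShell V (c + ζ) = layerShell s s := by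
  have hhcp : IsArrangedIn (kissingShell V c) hcpKissingPattern := by
    rw [hSc]; exact isArrangedIn_layerShell_hcp' hs
  obtain ⟨h1, h2⟩ := (mirror_iff_hexagon hs hSc).2 hζ
  rw [← hSc]
  exact kissingShell_add_eq_of_hcp hV hc hhcp h1 h2 hcp

/-- **STEP B: the hexagon of an FCC-type centre carries no HCP-type ball.** Frame form: the centre is
`0 ∈ V` with shell the cuboctahedron `layerShell σ (−σ)`; some polar neighbour `d` (not in the hexagon)
has the horizontal HCP shell `layerShell s s`; every neighbour `c` of `0` and every neighbour `c + y` of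
such a `c` has an FCC or HCP tangent arrangement. Then no hexagon neighbour `η` has an HCP tangent
arrangement. -/
theorem ring_not_hcp (hV : IsUnitBallPacking V) (h0 : (0 : EuclideanSpace ℝ (Fin 3)) ∈ V) {σ : ℝ}
    (hσ : σ = 1 ∨ σ = -1) (hS0 : kissingShell V 0 = layerShell σ (-σ))
    {d : EuclideanSpace ℝ (Fin 3)} (hd : d ∈ kissingShell V 0) (hdH : d ∉ hexagonSet) {s : ℝ}
    (hs : s = 1 ∨ s = -1) (hSd : kissingShell V d = layerShell s s)
    (hcp1 : ∀ c ∈ kissingShell V 0, IsArrangedIn (kissingShell V c) fccKissingPattern ∨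
      IsArrangedIn (kissingShell V c) hcpKissingPattern)
    (hcp2 : ∀ c ∈ kissingShell V 0, ∀ y ∈ kissingShell V c,
      IsArrangedIn (kissingShell V (c + y)) fccKissingPattern ∨
        IsArrangedIn (kissingShell V (c + y)) hcpKissingPattern)
    {η : EuclideanSpace ℝ (Fin 3)} (hη : η ∈ hexagonSet) :
    ¬ IsArrangedIn (kissingShell V η) hcpKissingPattern := by
  intro hhcp
  have hfcc0 : IsArrangedIn (kissingShell V 0) fccKissingPattern := by
    rw [hS0]; exact isArrangedIn_layerShell_fcc' hσ
  have mem0 : ∀ {c : EuclideanSpace ℝ (Fin 3)}, c ∈ kissingShell V 0 → c ∈ V := fun hc => by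
    simpa using hc.1
  have hηS : η ∈ kissingShell V 0 := hS0 ▸ hexagonSet_subset_layerShell _ _ hη
  have hηV : η ∈ V := mem0 hηS
  have hdV : d ∈ V := mem0 hd
  -- the mirror plane of `η` misses the centre
  have hηnot : η ∉ kissingShell V η := by
    intro h1
    have h2 : -η ∈ kissingShell V η :=
      ⟨by simpa using h0, by rw [norm_neg]; exact norm_of_mem_hexagonSet hη⟩
    have h3 := kissingShell_add_eq_of_hcp hV hηV hhcp h2 (by rw [neg_neg]; exact h1)
      (by rw [add_neg_cancel]; exact Or.inl hfcc0)
    rw [add_neg_cancel] at h3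
    have h4 : IsArrangedIn (kissingShell V 0) hcpKissingPattern := h3 ▸ hhcp
    obtain ⟨A, hA⟩ := isArrangedIn_hcp_iff_range.1 h4
    exact not_centrallySymmetric_of_hcp_range hA fun x hx => neg_mem_of_fcc hfcc0 hx
  -- the mirror directions of `η`: an isometric hexagon `H'`
  obtain ⟨L, s', hs', hSη⟩ := exists_hcp_frame hV hhcp
  have hSη' : kissingShell {z | η + L z ∈ V} 0 = L ⁻¹' kissingShell V η := by
    rw [kissingShell_moved]; simp
  have mirror : ∀ y : EuclideanSpace ℝ (Fin 3), L.symm y ∈ hexagonSet →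
      y ∈ kissingShell V η ∧ -y ∈ kissingShell V η := by
    intro y hy
    have h1 : L.symm y ∈ layerShell s' s' := hexagonSet_subset_layerShell _ _ hy
    have h2 : -L.symm y ∈ layerShell s' s' := hexagonSet_subset_layerShell _ _ (neg_mem_hexagonSet hy)
    rw [← hSη, hSη'] at h1 h2
    exact ⟨by simpa using h1, by simpa using h2⟩
  have mirror' : ∀ y : EuclideanSpace ℝ (Fin 3), y ∈ kissingShell V η → -y ∈ kissingShell V η →
      L.symm y ∈ hexagonSet := by
    intro y h1 h2
    have h1' : L.symm y ∈ layerShell s' s' := by rw [← hSη, hSη']; simpa using h1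
    have h2' : -L.symm y ∈ layerShell s' s' := by rw [← hSη, hSη']; simpa using h2
    exact mem_hexagonSet_of_neg_mem hs' h1' h2'
  set a : EuclideanSpace ℝ (Fin 3) := L (triangularVec₁ (2 : ℝ)) with ha_def
  set b : EuclideanSpace ℝ (Fin 3) := L (triangularVec₂ (2 : ℝ)) with hb_def
  have hab : ⟪a, b⟫ = 2 := by rw [ha_def, hb_def, LinearIsometryEquiv.inner_map_map]; simp
  have Hpre : ∀ y ∈ ({a, -a, b, -b, a - b, b - a} : Set (EuclideanSpace ℝ (Fin 3))),
      L.symm y ∈ hexagonSet := by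
    intro y hy
    simp only [Set.mem_insert_iff, Set.mem_singleton_iff] at hy
    rcases hy with rfl | rfl | rfl | rfl | rfl | rfl <;>
      simp only [ha_def, hb_def, map_neg, map_sub, LinearIsometryEquiv.symm_apply_apply, hexagonSet,
        Set.mem_insert_iff, Set.mem_singleton_iff, true_or, or_true]
  have memH : ∀ y ∈ ({a, -a, b, -b, a - b, b - a} : Set (EuclideanSpace ℝ (Fin 3))),
      y ∈ kissingShell V η ∧ -y ∈ kissingShell V η := fun y hy => mirror y (Hpre y hy)
  have negH : ∀ y ∈ ({a, -a, b, -b, a - b, b - a} : Set (EuclideanSpace ℝ (Fin 3))),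
      -y ∈ ({a, -a, b, -b, a - b, b - a} : Set (EuclideanSpace ℝ (Fin 3))) := by
    intro y hy
    simp only [Set.mem_insert_iff, Set.mem_singleton_iff] at hy ⊢
    rcases hy with rfl | rfl | rfl | rfl | rfl | rfl
    · exact Or.inr (Or.inl rfl)
    · exact Or.inl (neg_neg a)
    · exact Or.inr (Or.inr (Or.inr (Or.inl rfl)))
    · exact Or.inr (Or.inr (Or.inl (neg_neg b)))
    · exact Or.inr (Or.inr (Or.inr (Or.inr (Or.inr (neg_sub a b)))))
    · exact Or.inr (Or.inr (Or.inr (Or.inr (Or.inl (neg_sub b a)))))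
  -- `H' ⊆ shell of the centre` by hexagon transfer
  have HS0 : ({a, -a, b, -b, a - b, b - a} : Set (EuclideanSpace ℝ (Fin 3))) ⊆ layerShell σ (-σ) := by
    intro y hy
    rw [← hS0]
    obtain ⟨h1, h2⟩ := memH y hy
    refine hexagon_transfer hV h0 (by simpa using hηS) hhcp (by simpa using hηnot) ?_ h1 h2
    intro z hz _
    exact hcp2 η hηS z hz
  have haS : a ∈ layerShell σ (-σ) := HS0 (by simp)
  have hbS : b ∈ layerShell σ (-σ) := HS0 (by simp)
  have hηnotH : η ∉ ({a, -a, b, -b, a - b, b - a} : Set (EuclideanSpace ℝ (Fin 3))) :=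
    fun h => hηnot (memH η h).1
  by_cases htilt : ({a, -a, b, -b, a - b, b - a} : Set (EuclideanSpace ℝ (Fin 3))) ⊆ hexagonSet
  · -- the horizontal hexagon: then `η ∈ H'`, absurd
    have himg : ({a, -a, b, -b, a - b, b - a} : Set (EuclideanSpace ℝ (Fin 3))) = L '' hexagonSet := by
      rw [hexagonSet_eq_uv]
      simp only [Set.image_insert_eq, Set.image_singleton, map_neg, map_sub, ha_def, hb_def]
    have hcard : (hexagonSet : Set (EuclideanSpace ℝ (Fin 3))).ncard ≤
        ({a, -a, b, -b, a - b, b - a} : Set (EuclideanSpace ℝ (Fin 3))).ncard := by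
      rw [himg, Set.ncard_image_of_injective _ L.injective]
    have heq := Set.eq_of_subset_of_ncard_le htilt hcard
      ((finite_layerShell σ (-σ)).subset (hexagonSet_subset_layerShell σ (-σ)))
    exact hηnotH (by rw [heq]; exact hη)
  · -- a tilted hexagon: the witness lemma produces a ball with two mirror planes
    obtain ⟨p, hp, q, hq, hp1, hq1, hpq, hqH, hpH⟩ :=
      cubo_witness hσ haS hbS hab HS0 htilt (hS0 ▸ hd) hdH (hS0 ▸ hηS) hηnotH
    rw [← hS0] at hp hq
    -- the shells of `p` and `q`
    have hSp : kissingShell V p = layerShell s s := by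
      rcases hp1 with rfl | hp1
      · exact hSd
      · have h := shell_eq_of_layerShell hV hs hdV hSd hp1 (by rw [add_sub_cancel]; exact hcp1 p hp)
        rwa [add_sub_cancel] at h
    have hShcp : IsArrangedIn (kissingShell V η) hcpKissingPattern := hhcp
    have hSq : kissingShell V q = kissingShell V η := by
      rcases hq1 with rfl | hq1
      · rfl
      · obtain ⟨h1, h2⟩ := memH _ hq1
        have h := kissingShell_add_eq_of_hcp hV hηV hhcp h1 h2
          (by rw [add_sub_cancel]; exact hcp1 q hq)
        rwa [add_sub_cancel] at h
    -- the ball `p + q` has the shell of `p` and the shell of `q`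
    have hpV : p ∈ V := mem0 hp
    have hqV : q ∈ V := mem0 hq
    have hq_in_p : q ∈ kissingShell V p ∧ -q ∈ kissingShell V p := (mirror_iff_hexagon hs hSp).2 hqH
    have hp_in_q : p ∈ kissingShell V q ∧ -p ∈ kissingShell V q := by
      rw [hSq]; exact ⟨(memH p hpH).1, (memH (-p) (negH p hpH)).1⟩
    have hcp_pq : IsArrangedIn (kissingShell V (p + q)) fccKissingPattern ∨
        IsArrangedIn (kissingShell V (p + q)) hcpKissingPattern := hcp2 p hp q hq_in_p.1
    have e1 : kissingShell V (p + q) = kissingShell V p :=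
      kissingShell_add_eq_of_hcp hV hpV (by rw [hSp]; exact isArrangedIn_layerShell_hcp' hs)
        hq_in_p.1 hq_in_p.2 hcp_pq
    have e2 : kissingShell V (q + p) = kissingShell V q :=
      kissingShell_add_eq_of_hcp hV hqV (by rw [hSq]; exact hShcp) hp_in_q.1 hp_in_q.2
        (by rw [add_comm]; exact hcp_pq)
    rw [add_comm, e1, hSp, hSq] at e2
    -- hence `H'` is horizontal after all
    apply htilt
    intro y hy
    obtain ⟨h1, h2⟩ := memH y hy
    rw [← e2] at h1 h2
    exact mem_hexagonSet_of_neg_mem hs h1 h2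

end Summit.Ventures.Crystal3D.L2B
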